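import Summits.BirchSwinnertonDyer.BirchSwinnertonDyer.Theorems.AlignedTransportAtTwoMainConjectureOfRankZeroBSDAtTwoCubicOrderFourDoor
import Summits.BirchSwinnertonDyer.BirchSwinnertonDyer.Theorems.AlignedTransportAtTwoMainConjectureOfRankZeroBSDAtTwoCubicDepthDoorGenusCert
import Literature.NumberTheory.IwasawaTheory.ClassNumberPExpLayerOneEqTwoOfOrderFourCertificate
import HarnessLib

/-!
# Route `AlignedTransportAtTwo`, crux C2 `MainConjectureOfRankZeroBSDAtTwo` (stmt-BirchSwinnertonDyer-22298):
# THE ORDER-FOUR DOOR, EXACT FORM — `e₁ = ord₂ h(ℚ(β,√2)) = 2` EXACTLY on the u7 sub-cell (`Δ_min ≡ 5 (mod 8)`) from the order-four certificate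
# plus ONE genus bit (`q₀ ≡ ±3 (mod 𝔭₁³)` for the split prime under the order-four ideal)

HONEST FRAMING (cell `bsd-f1-sign2`, WIDTH-5 attached prover seat `bsd-line-att-p4` gen 40 on line `birth` of the lead `bsd-line-att-p2`;
`--supports` stmt-BirchSwinnertonDyer-22298, closes nothing; BSD is NOT proved by any of this; the crux C2, its verdict «blocked-on
`Rank1Residual.GreenbergMuConjectureIrreducible`» and every registered stub are untouched).  THEOREMS ONLY — no definition, no named fact, no `sorry`.
Sequel of this seat's `…CubicOrderFourDoor` (`e₁ ≥ 2`): the UPPER bound, by the elementary half of genus theory (att-p3 g43's dyadic genus character).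

WHAT.  `W/ℚ` globally minimal, good ordinary at `2`, no rational `2`-torsion abscissa, `Δ_min ≡ 5 (mod 8)` (exactly two primes of `ℚ(β)` above `2`:
`𝔭₁` of degree `1`, `𝔭₂` of degree `2`), `Δ_W < 0`; displayed: `h(ℚ(β))` odd, `2 ∤ d_{ℚ(β)}`, an ideal `𝔭₁` of norm `2`, a unit `ε ≡ ±1 (mod 𝔭₁³)` with `±ε`
non-squares (u7), the order-four certificate data in `𝓞_{ℚ(β)}` (`…CubicOrderFourDoor`), the norm identity `A² − 2B² = u·q₀⁴` (`u` a unit) and the genus bit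
`q₀ ≡ ±3 (mod 𝔭₁³)`.  THEN (★ `classNumberPExp_one_eq_two_adjoin_of_orderFourCert_of_genusBit`) `classNumberPExp κ 1 = 2` for every cyclotomic `κ`:
`Cl(ℚ(β,√2))[2^∞] ≅ ℤ/4`.  Customers (same seat, rows `…CubicOrderFourRowN<N>Exact`): `12163, 14539, 13971, 4307, 1187, 13547`.

References: [Gras2003] IV.4; [Serre1973CourseArithmetic] Ch. III §1.2 Thm. 1; [NeukirchANT1999] Ch. I §3, §7 Thm. (7.4), §8, Ch. III §1 (1.6); [Washington1997]
§13.1; [Cohen1993] §6.5, Prop. 4.8.11; tree: this seat's `…CubicOrderFourDoor`, Literature `NumberFields/QuadraticSqrtTwoOrderFourClassNotSquare`,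
`IwasawaTheory/ClassNumberPExpLayerOneEqTwoOfOrderFourCertificate`; att-p3 g43 `…CubicDepthDoorGenusCert` (the `𝔭₁`/Kilford plumbing).
-/

set_option linter.dupNamespace false
set_option autoImplicit false

noncomputable section

open scoped Classical NumberField nonZeroDivisors

namespace Summit.BirchSwinnertonDyer.BirchSwinnertonDyer.Theorems.AlignedTransportAtTwoCubicOrderFourDoor

open NumberField IsDedekindDomain Polynomial WeierstrassCurve IntermediateField CongruenceSubgroup
  Literature.NumberTheory.IwasawaTheory Literature.NumberTheory.GaloisRepresentations
  Literature.NumberTheory.EllipticCurves Literature.NumberTheory.EllipticCurves.Greenberg1999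
  Literature.NumberTheory.EllipticCurves.ModularForms
  Literature.NumberTheory.EllipticCurves.Rank1Residual
  Literature.NumberTheory.EllipticCurves.Module
  Literature.NumberTheory.NumberFields
  Summit.BirchSwinnertonDyer.Rank1Residual
  Summit.BirchSwinnertonDyer.Rank1Residual.X1.MuLambda
  Summit.BirchSwinnertonDyer.Rank1Residual.X5
  Summit.BirchSwinnertonDyer.Rank1Residual.F1Sign2
  Summit.BirchSwinnertonDyer.BirchSwinnertonDyer.Theorems.Rank1ResidualX1Defs
  Summit.BirchSwinnertonDyer.BirchSwinnertonDyer.Theses.AlignedTransportAtTwo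
  Summit.BirchSwinnertonDyer.BirchSwinnertonDyer.Theorems.AlignedTransportAtTwoKilfordStratumShared
  Summit.BirchSwinnertonDyer.BirchSwinnertonDyer.Theorems.AlignedTransportAtTwoCubicCarrierRoad
  Summit.BirchSwinnertonDyer.BirchSwinnertonDyer.Theorems.AlignedTransportAtTwoCubicKilfordPrimes
  Summit.BirchSwinnertonDyer.BirchSwinnertonDyer.Theorems.AlignedTransportAtTwoCubicPrimesOfEmbeddings
  Summit.BirchSwinnertonDyer.BirchSwinnertonDyer.Theorems.AlignedTransportAtTwoCubicOffStratumRamification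
  Summit.BirchSwinnertonDyer.BirchSwinnertonDyer.Theorems.AlignedTransportAtTwoCubicLayerOneDoors
  Summit.BirchSwinnertonDyer.BirchSwinnertonDyer.Theorems.AlignedTransportAtTwoCubicDepthDoorGenusCert

variable (W : WeierstrassCurve ℚ) [W.IsElliptic] [W.IsGloballyMinimal]

/-- ★ **`e₁(κ) = 2` EXACTLY FOR THE CUBIC `2`-TORSION FIELD** from the order-four certificate plus one genus bit.  `W/ℚ` globally minimal, good ordinary
at `2`, no rational `2`-torsion abscissa, `Δ_min ≡ 5 (mod 8)`, `Δ_W < 0`; `β` a root of the `2`-division cubic; displayed: `h(ℚ(β))` odd, `2 ∤ d_{ℚ(β)}`, an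
ideal `𝔭₁` of norm `2`, a unit `ε ≡ ±1 (mod 𝔭₁³)` with `±ε` non-squares; the order-four certificate data (three units, `w`, `w*`, Bézout, `q₀ ≠ 0`, `v`,
witnesses, `31` residue certificates); `A² − 2B² = u·q₀⁴` with `u` a unit; `q₀ ≡ ±3 (mod 𝔭₁³)`.  THEN `classNumberPExp κ 1 = 2` for every cyclotomic `κ`.
[cite: Gras2003, IV.4] [cite: Serre1973CourseArithmetic, Ch. III §1.2, Thm. 1] [cite: NeukirchANT1999, Ch. I §7 Thm. (7.4), Ch. III §1 (1.6)]
[cite: Washington1997, §13.1] [cite: Cohen1993, §6.5 and Prop. 4.8.11] -/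
theorem classNumberPExp_one_eq_two_adjoin_of_orderFourCert_of_genusBit (hord : IsOrdinaryAt W 2)
    (ht : ∀ x : ℚ, ¬ HasRationalTwoTorsionX W x) (h85 : minimalDiscriminantInt W % 8 = 5) (hΔ : W.Δ < 0)
    {β : AlgebraicClosure ℚ} (hβ : aeval β W.twoTorsionPolynomial.toPoly = 0)
    (hh : haveI : FiniteDimensional ℚ ↥(IntermediateField.adjoin ℚ ({β} : Set (AlgebraicClosure ℚ))) :=
        IntermediateField.adjoin.finiteDimensional ((AlgebraicClosure.isAlgebraic ℚ).isAlgebraic β).isIntegral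
      haveI : NumberField ↥(IntermediateField.adjoin ℚ ({β} : Set (AlgebraicClosure ℚ))) := NumberField.mk
      ¬ 2 ∣ classNumber ↥(IntermediateField.adjoin ℚ ({β} : Set (AlgebraicClosure ℚ))))
    (hd : haveI : FiniteDimensional ℚ ↥(IntermediateField.adjoin ℚ ({β} : Set (AlgebraicClosure ℚ))) :=
        IntermediateField.adjoin.finiteDimensional ((AlgebraicClosure.isAlgebraic ℚ).isAlgebraic β).isIntegral
      haveI : NumberField ↥(IntermediateField.adjoin ℚ ({β} : Set (AlgebraicClosure ℚ))) := NumberField.mk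
      ¬ (2 : ℤ) ∣ NumberField.discr ↥(IntermediateField.adjoin ℚ ({β} : Set (AlgebraicClosure ℚ))))
    (𝔭₁ : Ideal (𝓞 ↥(IntermediateField.adjoin ℚ ({β} : Set (AlgebraicClosure ℚ)))))
    (hN : haveI : FiniteDimensional ℚ ↥(IntermediateField.adjoin ℚ ({β} : Set (AlgebraicClosure ℚ))) :=
        IntermediateField.adjoin.finiteDimensional ((AlgebraicClosure.isAlgebraic ℚ).isAlgebraic β).isIntegral
      haveI : NumberField ↥(IntermediateField.adjoin ℚ ({β} : Set (AlgebraicClosure ℚ))) := NumberField.mk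
      Ideal.absNorm 𝔭₁ = 2)
    {ε : (𝓞 ↥(IntermediateField.adjoin ℚ ({β} : Set (AlgebraicClosure ℚ))))ˣ}
    (hε : (ε : 𝓞 ↥(IntermediateField.adjoin ℚ ({β} : Set (AlgebraicClosure ℚ)))) - 1 ∈ 𝔭₁ ^ 3 ∨
      (ε : 𝓞 ↥(IntermediateField.adjoin ℚ ({β} : Set (AlgebraicClosure ℚ)))) + 1 ∈ 𝔭₁ ^ 3)
    (hnsq : ∀ y : (𝓞 ↥(IntermediateField.adjoin ℚ ({β} : Set (AlgebraicClosure ℚ))))ˣ, ε ≠ y ^ 2 ∧ ε ≠ -y ^ 2)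
    {a₁ b₁ c₁ d₁ a₂ b₂ c₂ d₂ a₃ b₃ c₃ d₃ A B W₀ W₁ μ₀ μ₁ ν₀ ν₁ q₀ v₀ v₁ α₀ α₁ β₀ β₁ γ₀ γ₁ δ₀ δ₁ m₀ m₁ n₀ n₁ l₀ l₁ :
      𝓞 ↥(IntermediateField.adjoin ℚ ({β} : Set (AlgebraicClosure ℚ)))}
    (hu₁ : a₁ * c₁ + 2 * b₁ * d₁ = 1 ∧ a₁ * d₁ + b₁ * c₁ = 0)
    (hu₂ : a₂ * c₂ + 2 * b₂ * d₂ = 1 ∧ a₂ * d₂ + b₂ * c₂ = 0)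
    (hu₃ : a₃ * c₃ + 2 * b₃ * d₃ = 1 ∧ a₃ * d₃ + b₃ * c₃ = 0)
    (hws : q₀ ^ 4 = A * W₀ + 2 * B * W₁ ∧ (0 : 𝓞 ↥(IntermediateField.adjoin ℚ ({β} : Set (AlgebraicClosure ℚ)))) = A * W₁ + B * W₀)
    (hbez : μ₀ * A + 2 * μ₁ * B + ν₀ * W₀ + 2 * ν₁ * W₁ = 1 ∧ μ₀ * B + μ₁ * A + ν₀ * W₁ + ν₁ * W₀ = 0)
    (hq₀ : q₀ ≠ 0)
    (hM2 : q₀ * v₀ = α₀ * A + 2 * α₁ * B + β₀ * q₀ ^ 2 ∧ q₀ * v₁ = α₀ * B + α₁ * A + β₁ * q₀ ^ 2)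
    (hM3 : v₀ ^ 2 + 2 * v₁ ^ 2 = γ₀ * A + 2 * γ₁ * B + δ₀ * q₀ ^ 2 ∧ 2 * v₀ * v₁ = γ₀ * B + γ₁ * A + δ₁ * q₀ ^ 2)
    (hM4 : A = m₀ * q₀ ^ 2 + (n₀ * (q₀ * v₀) + 2 * n₁ * (q₀ * v₁)) + (l₀ * (v₀ ^ 2 + 2 * v₁ ^ 2) + 2 * l₁ * (2 * v₀ * v₁)) ∧
      B = m₁ * q₀ ^ 2 + (n₀ * (q₀ * v₁) + n₁ * (q₀ * v₀)) + (l₀ * (2 * v₀ * v₁) + l₁ * (v₀ ^ 2 + 2 * v₁ ^ 2)))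
    (hcert : ∀ (e₁ e₂ e₃ e₄ : ℕ) (σ : ℤˣ), e₁ ≤ 1 → e₂ ≤ 1 → e₃ ≤ 1 → e₄ ≤ 1 →
      ¬ (e₁ = 0 ∧ e₂ = 0 ∧ e₃ = 0 ∧ e₄ = 0 ∧ σ = 1) →
      ∃ (q : ℕ) (ψ : 𝓞 ↥(IntermediateField.adjoin ℚ ({β} : Set (AlgebraicClosure ℚ))) →+* ZMod q) (t : ZMod q)
        (ρ : 𝓞 ↥(IntermediateField.adjoin ℚ ({β} : Set (AlgebraicClosure ℚ)))), 2 * t = 1 ∧ ψ ρ ^ 2 = 2 ∧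
        ¬ IsSquare (((σ : ℤ) : ZMod q) * (ψ a₁ + ψ b₁ * ψ ρ) ^ e₁ * (ψ a₂ + ψ b₂ * ψ ρ) ^ e₂ *
          (ψ a₃ + ψ b₃ * ψ ρ) ^ e₃ * (ψ A + ψ B * ψ ρ) ^ e₄))
    {uw : (𝓞 ↥(IntermediateField.adjoin ℚ ({β} : Set (AlgebraicClosure ℚ))))ˣ}
    (hNw : A ^ 2 - 2 * B ^ 2 = (uw : 𝓞 ↥(IntermediateField.adjoin ℚ ({β} : Set (AlgebraicClosure ℚ)))) * q₀ ^ 4)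
    (hq : q₀ - 3 ∈ 𝔭₁ ^ 3 ∨ q₀ + 3 ∈ 𝔭₁ ^ 3)
    (κP : ZpExtension ↥(IntermediateField.adjoin ℚ ({β} : Set (AlgebraicClosure ℚ))) 2) (hκP : κP.IsCyclotomic) :
    classNumberPExp κP 1 = 2 := by
  have hirr := AlignedTransportAtTwoSeed.irr_two_of_forall_not_hasRationalTwoTorsionX W ht
  have hβint : IsIntegral ℚ β := ((AlgebraicClosure.isAlgebraic ℚ).isAlgebraic β).isIntegral
  haveI : FiniteDimensional ℚ ↥(IntermediateField.adjoin ℚ ({β} : Set (AlgebraicClosure ℚ))) :=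
    IntermediateField.adjoin.finiteDimensional hβint
  haveI : NumberField ↥(IntermediateField.adjoin ℚ ({β} : Set (AlgebraicClosure ℚ))) := NumberField.mk
  haveI : FiniteDimensional ↥(IntermediateField.adjoin ℚ ({β} : Set (AlgebraicClosure ℚ))) (κP.layer 1) :=
    κP.finiteDimensional_layer_holds 1
  haveI : NumberField (κP.layer 1) := NumberField.of_module_finite ↥(IntermediateField.adjoin ℚ ({β} : Set (AlgebraicClosure ℚ))) _
  have h3 : Module.finrank ℚ ↥(IntermediateField.adjoin ℚ ({β} : Set (AlgebraicClosure ℚ))) = 3 :=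
    AddKatoTwo.finrank_adjoin_root_twoTorsionPolynomial_eq_three W hirr hβ
  have hodd3 : ¬ 2 ∣ Module.finrank ℚ ↥(IntermediateField.adjoin ℚ ({β} : Set (AlgebraicClosure ℚ))) := by rw [h3]; decide
  have hodd : Odd (classNumber ↥(IntermediateField.adjoin ℚ ({β} : Set (AlgebraicClosure ℚ)))) :=
    Nat.odd_iff.mpr (Nat.two_dvd_ne_zero.mp hh)
  have hr1 := nrRealPlaces_adjoin_root_twoTorsionPolynomial_eq_one W hΔ hirr hβ
  have hrank : Units.rank ↥(IntermediateField.adjoin ℚ ({β} : Set (AlgebraicClosure ℚ))) = 1 :=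
    units_rank_eq_one_of_nrRealPlaces_eq_one _ h3 hr1
  have hreal : 0 < InfinitePlace.nrRealPlaces ↥(IntermediateField.adjoin ℚ ({β} : Set (AlgebraicClosure ℚ))) := by rw [hr1]; exact one_pos
  have hPl : Fintype.card (InfinitePlace ↥(IntermediateField.adjoin ℚ ({β} : Set (AlgebraicClosure ℚ)))) ≤ 2 := by
    have h := InfinitePlace.card_add_two_mul_card_eq_rank (K := ↥(IntermediateField.adjoin ℚ ({β} : Set (AlgebraicClosure ℚ))))
    rw [h3, hr1] at h
    rw [InfinitePlace.card_eq_nrRealPlaces_add_nrComplexPlaces, hr1]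
    omega
  have h8 : minimalDiscriminantInt W % 8 ≠ 1 := by rw [h85]; decide
  have hs := (not_onKilfordStratumAtTwo_iff_minimalDiscriminantInt_emod_eight_ne W hord).mpr h8
  have h2 := ncard_eq_two_of_not_onKilfordStratumAtTwo ↥(IntermediateField.adjoin ℚ ({β} : Set (AlgebraicClosure ℚ))) W hord ht h3
    (AlignedTransportAtTwoCubicKilfordPrimes.aeval_four_mul_gen_twoDivisionUCubic W hβ) hs
  exact classNumberPExp_one_eq_two_of_orderFourCert_of_genusBit_of_rank_eq_one hodd3 hd hreal hPl κP hκP hu₁ hu₂ hu₃ hws hbez hq₀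
    hM2 hM3 hM4 hcert hodd h2.le hrank 𝔭₁ hN hε hnsq hNw hq

end Summit.BirchSwinnertonDyer.BirchSwinnertonDyer.Theorems.AlignedTransportAtTwoCubicOrderFourDoor

end
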